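import Summits.PneNP.PneNP.Theses.SzkEntropy
import Summits.PneNP.PneNP.Theorems.SzkEntropyPeaWorstToAvgReductions
import Summits.PneNP.PneNP.Theorems.SzkEntropyPeaWorstToAvgOrbit
import Literature.Computability.MetaComplexity.PromiseRandReductions
import Summits.PneNP.PneNP.Theorems.SzkEntropyPeaWorstToAvgDualModeCompileDefs

set_option linter.dupNamespace false

/-!
# Line `orbit-pair-rsr` — skeleton for crux `SzkEntropy.PeaWorstToAvg` (stmt-PneNP-10777)

Crux (route `PneNP/SzkEntropy`, decl `Summit.PneNP.PneNP.Theses.SzkEntropy.PeaWorstToAvg`):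
`PEA 3 ∉ PromiseBPP' → ∃ D, D.IsPolySamplable ∧ supp Dₙ ⊆ yes ∪ no ∧ ((PEA 3).yes, D) ∉ HeurBPP`.

Idea card `Cruxes/PeaWorstToAvg/Ideas/orbit-pair-rsr.md` (triage r1: pass ×3).  The action of
`Aff_s(F₂) × Aff_m(F₂)` on cubic maps `q ↦ (B·+c) ∘ q ∘ (A·+b)` preserves degree `≤ 3` and the output
entropy EXACTLY, so the ORBIT-MEMBERSHIP promise problem `OrbitPair p₀ p₁ k` of an explicit
entropy-separated pair of cubic families is random-self-reducible by re-randomisation inside the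
orbit: `HeurBPP`-easiness of the planted ensemble `½·U(orbit p₀ˢ) + ½·U(orbit p₁ˢ)` already puts
`OrbitPair` in (uniform) `PromiseBPP'`.  Hence the crux follows from ONE worst-case statement, the
transfer `stub_transfer` (C⁺ of the card, in the RANDOMIZED-Karp form asked for by triage r1-1 §3):
`PEA 3` reduces to some such orbit pair.  The four other stubs are the provable-now machine lemmas the
triage and the prover seat asked to budget explicitly (advice elimination by labelled self-testing,
uniform planted sampler / re-randomiser, closure of `PromiseBPP'` under randomized reductions, the RSR
decider itself).

Layout: §1 objects of the line (definitions only — landed verbatim by the lead as the Theorems defs file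
`SzkEntropyPeaWorstToAvgOrbitPairRsrDefs.lean` so that stub proofs can state the registered signatures; `UHeurBPP` is the
`dual-mode-compile` line's, shared); §2 the five stubs (`sorry`);
§3 sorry-free glue; §4 the composition `conclusion_of_parts` (arrow form) and `PeaWorstToAvg_of`
(concludes the crux BY NAME from the stubs).
-/

namespace Summit.PneNP.PneNP.Cruxes.PeaWorstToAvg.OrbitPairRsr

open Literature.Computability.Complexity Literature.Computability.MetaComplexity
open _root_.Computability
open Summit.PneNP.PneNP.Theorems
open Summit.PneNP.PneNP.Cruxes.PeaWorstToAvg.DualModeCompile (UHeurBPP)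

/-! ## §1 Objects of the line -/

/-- Affine relabelling of output words: `l ↦ B·v(l) + c` where `v(l) ∈ F₂^m` reads the first `m`
letters of `l` (default `0`), written back as a word of length `m`. -/
def affOut {m : ℕ} (B : Matrix (Fin m) (Fin m) (ZMod 2)) (c : Fin m → ZMod 2)
    (l : List (ZMod 2)) : List (ZMod 2) :=
  List.ofFn (B.mulVec (fun i : Fin m => l.getD i 0) + c)

/-- Affine equivalence of sparse cubic maps on the same `s` variables (semantic, as functions
`F₂ˢ → F₂^m`, `m = P.length`): `Q = (B·+c) ∘ P ∘ (A·+b)` with `A ∈ GL_s(F₂)`, `B ∈ GL_m(F₂)`.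
(Patarin's IP2S relation restricted to equal formats.) -/
def AffEquiv {s : ℕ} (P Q : PolyMapF2 s) : Prop :=
  ∃ (A : Matrix (Fin s) (Fin s) (ZMod 2)) (b : Fin s → ZMod 2)
    (B : Matrix (Fin P.length) (Fin P.length) (ZMod 2)) (c : Fin P.length → ZMod 2),
    IsUnit A ∧ IsUnit B ∧ ∀ x : Fin s → ZMod 2, Q.eval x = affOut B c (P.eval (A.mulVec x + b))

/-- The orbit instances of an explicit family `p = (pˢ)ₛ` with thresholds `k`: PEA instances
`⟨s, (q, j)⟩` with `s ≥ 1`, `j = k s`, `q` of syntactic degree `≤ 3` and affinely equivalent to `pˢ`. -/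
def OrbitSet (p : (s : ℕ) → PolyMapF2 s) (k : ℕ → ℕ) : Set PEAInst :=
  {I | 1 ≤ I.1 ∧ I.2.2 = k I.1 ∧ PolyMapF2.DegLE 3 I.2.1 ∧ AffEquiv (p I.1) I.2.1}

/-- **The orbit-pair promise problem** of two explicit cubic families: YES = orbit instances of `p₁`,
NO = orbit instances of `p₀` (same encoding as `PEA`, so that `OrbitPair ≤ₚ PEA 3` by the identity
once the pair is entropy-separated, `orbitPair_polyTimeReducible_PEA`). -/
noncomputable def OrbitPair (p₀ p₁ : (s : ℕ) → PolyMapF2 s) (k : ℕ → ℕ) : PromiseProblem :=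
  PromiseProblem.ofEncoding PEAInst.encoding (OrbitSet p₁ k) (OrbitSet p₀ k)

/-- The size-`s` slice of the orbit instances of `p`, as a language. -/
def Side (p : (s : ℕ) → PolyMapF2 s) (k : ℕ → ℕ) (s : ℕ) : Set (List Bool) :=
  PEAInst.encoding.toLanguage {I | I ∈ OrbitSet p k ∧ I.1 = s}

/-- The two families of a pair, indexed by the answer bit (`false ↦ p₀`, `true ↦ p₁`). -/
def bySide (p₀ p₁ : (s : ℕ) → PolyMapF2 s) : Bool → (s : ℕ) → PolyMapF2 s
  | false => p₀
  | true => p₁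

/-- `P`-uniformity of an explicit instance sequence: `1ˢ ↦ ⟨s, (pˢ, k s)⟩` is in `FP`. -/
def IsPUniform (p : (s : ℕ) → PolyMapF2 s) (k : ℕ → ℕ) : Prop :=
  ∃ f ∈ FP, ∀ s : ℕ, f (unaryEncodeNat s) = PEAInst.encoding.encode ⟨s, (p s, k s)⟩

/-- Entropy separation across the threshold from size `1` on (size `0` carries only entropy `0`;
triage r1 sharpening 1): `H(p₀ˢ) ≤ k s < k s + 1 ≤ H(p₁ˢ)` for all `s ≥ 1`. -/
def Separated (p₀ p₁ : (s : ℕ) → PolyMapF2 s) (k : ℕ → ℕ) : Prop :=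
  ∀ s : ℕ, 1 ≤ s → (p₀ s).entropy ≤ k s ∧ (k s : ℝ) + 1 ≤ (p₁ s).entropy

/-- **Orbit kit** of a pair: a UNIFORM (honest polynomial coin budget — no `coinLen` advice) planted
sampler `samp b` of the size-`(n+1)` orbit of `p_b`, and an in-orbit re-randomiser `rer`, whose law
on any point of that orbit is `1/16`-close (one-sided, on every event) to the planted law.  Built in
`stub_orbitKit` from: canonical multilinear normal form of `(B·+c) ∘ q ∘ (A·+b)` in `FP`, and a
truncated-rejection sampler of `GL(F₂)` (law `(1-f)·U(GL) + f·δ_I`, `f ≤ 0.72^t`). -/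
structure OrbitKit (p₀ p₁ : (s : ℕ) → PolyMapF2 s) (k : ℕ → ℕ) where
  /-- planted sampler of side `b` on input `1ⁿ` (instances of size `n + 1`) -/
  samp : Bool → RandAlg ℕ (List Bool)
  samp_polyTime : ∀ b, (samp b).IsPolyTime unaryEncodeNat (id : List Bool → List Bool)
  /-- its coin budget is this polynomial of the input length (uniformity) -/
  sampCoins : Polynomial ℕ
  samp_coinLen : ∀ b ℓ, (samp b).coinLen ℓ = sampCoins.eval ℓ
  samp_support : ∀ b n, ∀ w ∈ ((samp b).outputPMF unaryEncodeNat n).support,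
    w ∈ Side (bySide p₀ p₁ b) k (n + 1)
  /-- in-orbit re-randomiser on instance strings -/
  rer : RandAlg (List Bool) (List Bool)
  rer_polyTime : rer.IsPolyTime (id : List Bool → List Bool) (id : List Bool → List Bool)
  rerCoins : Polynomial ℕ
  rer_coinLen : ∀ ℓ, rer.coinLen ℓ = rerCoins.eval ℓ
  rer_side : ∀ b s, ∀ w ∈ Side (bySide p₀ p₁ b) k s, ∀ w' ∈ (rer.outputPMF id w).support,
    w' ∈ Side (bySide p₀ p₁ b) k s
  rer_close : ∀ b n, ∀ w ∈ Side (bySide p₀ p₁ b) k (n + 1), ∀ E : Set (List Bool),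
    rer.pr id w E ≤ (samp b).pr unaryEncodeNat n E + 1 / 16

namespace OrbitKit

variable {p₀ p₁ : (s : ℕ) → PolyMapF2 s} {k : ℕ → ℕ}

/-- The planted law of side `b`: `n ↦` law of `samp b` on `1ⁿ`. -/
noncomputable def law (kit : OrbitKit p₀ p₁ k) (b : Bool) : Ensemble := fun n =>
  (kit.samp b).outputPMF unaryEncodeNat n

/-- The hard ensemble of the line: the fair mixture of the two planted laws. -/
noncomputable def mix (kit : OrbitKit p₀ p₁ k) : Ensemble :=
  mixEnsemble (kit.law false) (kit.law true)

end OrbitKit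

/- `UHeurBPP` (uniform heuristic schemes: honest polynomial coin budget) is NOT redeclared in this line: it is
`Summit.PneNP.PneNP.Cruxes.PeaWorstToAvg.DualModeCompile.UHeurBPP` (landed, `SzkEntropyPeaWorstToAvgDualModeCompileDefs.lean`,
opened above), so that `stub_adviceElim` below is LITERALLY the proposition registered by the `dual-mode-compile` line
(shared stub; whichever line lands it serves both). -/

/-! ## §2 The stubs -/

/-- **stub_transfer (C⁺, the hardest stub; research-level).** Some `P`-uniform pair of cubic
families, padded to `≥ s` outputs, entropy-separated across `k` from size `1` on, receives a
RANDOMIZED polynomial-time Karp reduction from `PEA 3` (tree `PromiseRandReducible`: uniform coins,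
success `≥ 2/3` on the promise).  Informally: cubic entropy approximation reduces to hidden affine
equivalence with an entropy gap (an `IP2S`/tensor-isomorphism-type problem).  Side information /
poly(s) target pairs are absorbed into the size index `s` (pad variables). -/
theorem stub_transfer :
    ∃ (p₀ p₁ : (s : ℕ) → PolyMapF2 s) (k : ℕ → ℕ),
      IsPUniform p₀ k ∧ IsPUniform p₁ k ∧ (∀ s, (p₀ s).DegLE 3) ∧ (∀ s, (p₁ s).DegLE 3) ∧
      (∀ s, s ≤ (p₀ s).length ∧ s ≤ (p₁ s).length) ∧ Separated p₀ p₁ k ∧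
      PromiseRandReducible (PEA 3) (OrbitPair p₀ p₁ k) := by
  sorry

/-- **stub_randClosure.** Textbook promise-`BPP` is closed downwards under randomized Karp
reductions with uniform coin budget (amplify the decider of `Q₂`, compose, majority over
independent repetitions of reduction+decision; the deterministic case is the tree's
`mem_PromiseBPP'_of_polyTimeReducible_holds`). [AroraBarak2009 §7.6; Goldreich2006 §1.2] -/
theorem stub_randClosure (Q₁ Q₂ : PromiseProblem) (h₁₂ : PromiseRandReducible Q₁ Q₂)
    (h₂ : Q₂ ∈ PromiseBPP') : Q₁ ∈ PromiseBPP' := by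
  sorry

/-- **stub_orbitKit.** For `P`-uniform cubic families with `≥ s` outputs there is an orbit kit:
`samp b (1ⁿ)` = canonical multilinear form of `(B·+c) ∘ p_b^{n+1} ∘ (A·+b')` for a
truncated-rejection-uniform `(A, B) ∈ GL_{n+1} × GL_m` and uniform shifts, threshold `k (n+1)`;
`rer` applies the same to the map read off its input and copies the threshold; both with explicit
polynomial coin budgets; `rer_close` by right-invariance of `U(GL)` (defect `2f ≤ 1/16`). -/
theorem stub_orbitKit (p₀ p₁ : (s : ℕ) → PolyMapF2 s) (k : ℕ → ℕ)
    (hu₀ : IsPUniform p₀ k) (hu₁ : IsPUniform p₁ k)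
    (hd₀ : ∀ s, (p₀ s).DegLE 3) (hd₁ : ∀ s, (p₁ s).DegLE 3)
    (hlen : ∀ s, s ≤ (p₀ s).length ∧ s ≤ (p₁ s).length) :
    Nonempty (OrbitKit p₀ p₁ k) := by
  sorry

/-- **stub_adviceElim (advice elimination by labelled self-testing).** If the two components of a
fair mixture are sampled by UNIFORM samplers and are contained in the NO resp. YES side of a disjoint
promise problem (so samples come LABELLED), then every advice-taking heuristic scheme for
`(Q.yes, mixture)` yields a uniform one: pad the failure parameter to a fixed length, enumerate the
candidate coin budgets, estimate each candidate's error on fresh labelled samples, run a passing one. -/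
theorem stub_adviceElim (Q : PromiseProblem) (hQ : Q.Disjoint)
    (S : Bool → RandAlg ℕ (List Bool))
    (hS : ∀ b, (S b).IsPolyTime unaryEncodeNat (id : List Bool → List Bool))
    (c : Polynomial ℕ) (hc : ∀ b ℓ, (S b).coinLen ℓ = c.eval ℓ)
    (h₀ : ∀ n, ∀ w ∈ ((S false).outputPMF unaryEncodeNat n).support, w ∈ Q.no)
    (h₁ : ∀ n, ∀ w ∈ ((S true).outputPMF unaryEncodeNat n).support, w ∈ Q.yes)
    (h : (⟨Q.yes, mixEnsemble (fun n => (S false).outputPMF unaryEncodeNat n)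
        (fun n => (S true).outputPMF unaryEncodeNat n)⟩ : DistProblem) ∈ HeurBPP) :
    (⟨Q.yes, mixEnsemble (fun n => (S false).outputPMF unaryEncodeNat n)
        (fun n => (S true).outputPMF unaryEncodeNat n)⟩ : DistProblem) ∈ UHeurBPP := by
  sorry

/-- **stub_orbitRSR (the orbit random self-reduction).** A uniform heuristic scheme for
`(OrbitPair.yes, planted mixture)` decides `OrbitPair` in the worst case: on an instance of size
`s = n + 1`, re-randomise it inside its orbit with `kit.rer`, run the scheme with failure parameter
`64` and its (computable) coin budget, repeat and take the majority; the bad set has planted mass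
`≤ 2/64`, the query law is `1/16`-close to the planted law, so each run is correct w.p. `> 1/2 + Ω(1)`. -/
theorem stub_orbitRSR (p₀ p₁ : (s : ℕ) → PolyMapF2 s) (k : ℕ → ℕ) (kit : OrbitKit p₀ p₁ k)
    (hlen : ∀ s, s ≤ (p₀ s).length ∧ s ≤ (p₁ s).length) (hdisj : (OrbitPair p₀ p₁ k).Disjoint)
    (h : (⟨(OrbitPair p₀ p₁ k).yes, kit.mix⟩ : DistProblem) ∈ UHeurBPP) :
    OrbitPair p₀ p₁ k ∈ PromiseBPP' := by
  sorry

/-! ## §3 Glue (sorry-free) -/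

section Glue

variable {p₀ p₁ : (s : ℕ) → PolyMapF2 s} {k : ℕ → ℕ}

/-- Affinely equivalent maps have the same output entropy (tree: `PolyMapF2.entropy_eq_of_semiconj`,
`exists_equiv_affineInput`, `affineOutput_injective`). -/
theorem AffEquiv.entropy_eq {s : ℕ} {P Q : PolyMapF2 s} (h : AffEquiv P Q) :
    Q.entropy = P.entropy := by
  obtain ⟨A, b, B, c, hA, hB, hQ⟩ := h
  obtain ⟨e, he⟩ := exists_equiv_affineInput A hA b
  refine Summit.PneNP.PneNP.Theorems.PolyMapF2.entropy_eq_of_semiconj P Q e (affOut B c)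
    (fun a a' haa' => ?_) (fun x => by rw [hQ x, he x])
  have h1 : B.mulVec (fun i : Fin P.length => (P.eval a).getD i 0) + c =
      B.mulVec (fun i : Fin P.length => (P.eval a').getD i 0) + c :=
    List.ofFn_injective haa'
  have h2 : (fun i : Fin P.length => (P.eval a).getD i 0) =
      (fun i : Fin P.length => (P.eval a').getD i 0) :=
    affineOutput_injective B hB c h1
  refine List.ext_getElem (by simp) fun i hi hi' => ?_
  have hiP : i < P.length := by simpa using hi
  have h3 := congr_fun h2 ⟨i, hiP⟩
  simp only at h3
  rwa [List.getD_eq_getElem _ _ hi, List.getD_eq_getElem _ _ hi'] at h3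

/-- YES orbit instances of a separated pair are YES instances of `PEA 3`. -/
theorem orbitSet_yes_subset (hsep : Separated p₀ p₁ k) :
    OrbitSet p₁ k ⊆ {I : PEAInst | PolyMapF2.DegLE 3 I.2.1 ∧ (I.2.2 : ℝ) + 1 ≤ PolyMapF2.entropy I.2.1} := by
  rintro ⟨s, q, j⟩ ⟨hs, hj, hdeg, haff⟩
  refine ⟨hdeg, ?_⟩
  dsimp only at hs hj hdeg haff ⊢
  rw [hj, haff.entropy_eq]
  exact (hsep s hs).2

/-- NO orbit instances of a separated pair are NO instances of `PEA 3`. -/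
theorem orbitSet_no_subset (hsep : Separated p₀ p₁ k) :
    OrbitSet p₀ k ⊆ {I : PEAInst | PolyMapF2.DegLE 3 I.2.1 ∧ PolyMapF2.entropy I.2.1 ≤ (I.2.2 : ℝ)} := by
  rintro ⟨s, q, j⟩ ⟨hs, hj, hdeg, haff⟩
  refine ⟨hdeg, ?_⟩
  dsimp only at hs hj hdeg haff ⊢
  rw [hj, haff.entropy_eq]
  exact (hsep s hs).1

/-- `OrbitPair.yes ⊆ (PEA 3).yes` for a separated pair. -/
theorem orbitPair_yes_le (hsep : Separated p₀ p₁ k) : (OrbitPair p₀ p₁ k).yes ≤ (PEA 3).yes :=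
  PEAInst.encoding.toLanguage_mono (orbitSet_yes_subset hsep)

/-- `OrbitPair.no ⊆ (PEA 3).no` for a separated pair. -/
theorem orbitPair_no_le (hsep : Separated p₀ p₁ k) : (OrbitPair p₀ p₁ k).no ≤ (PEA 3).no :=
  PEAInst.encoding.toLanguage_mono (orbitSet_no_subset hsep)

/-- **`OrbitPair ≤ₚ PEA 3` by the identity map** (entropy is an orbit invariant). -/
theorem orbitPair_polyTimeReducible_PEA (hsep : Separated p₀ p₁ k) :
    (OrbitPair p₀ p₁ k).PolyTimeReducible (PEA 3) :=
  ⟨id, PolyTimeComputable.id _, fun _ hw => orbitPair_yes_le hsep hw,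
    fun _ hw => orbitPair_no_le hsep hw⟩

/-- A separated orbit pair is a disjoint promise problem. -/
theorem orbitPair_disjoint (hsep : Separated p₀ p₁ k) : (OrbitPair p₀ p₁ k).Disjoint :=
  Disjoint.mono (orbitPair_yes_le hsep) (orbitPair_no_le hsep) (PEA_disjoint 3)

/-- A size slice of the `p₁`-orbit instances lies in YES. -/
theorem side_one_subset_yes (s : ℕ) : Side p₁ k s ⊆ (OrbitPair p₀ p₁ k).yes :=
  PEAInst.encoding.toLanguage_mono fun _ hI => hI.1

/-- A size slice of the `p₀`-orbit instances lies in NO. -/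
theorem side_zero_subset_no (s : ℕ) : Side p₀ k s ⊆ (OrbitPair p₀ p₁ k).no :=
  PEAInst.encoding.toLanguage_mono fun _ hI => hI.1

namespace OrbitKit

/-- The planted laws are polynomial-time samplable (by their very samplers). -/
theorem isPolySamplable_law (kit : OrbitKit p₀ p₁ k) (b : Bool) : (kit.law b).IsPolySamplable :=
  ⟨kit.samp b, kit.samp_polyTime b, fun _ => rfl⟩

/-- The mixture is polynomial-time samplable (tree: `Ensemble.isPolySamplable_mixEnsemble`). -/
theorem isPolySamplable_mix (kit : OrbitKit p₀ p₁ k) : kit.mix.IsPolySamplable :=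
  Ensemble.isPolySamplable_mixEnsemble (kit.isPolySamplable_law false) (kit.isPolySamplable_law true)

/-- The planted law of side `false` lives on NO instances. -/
theorem law_false_support (kit : OrbitKit p₀ p₁ k) (n : ℕ) (w : List Bool)
    (hw : w ∈ (kit.law false n).support) : w ∈ (OrbitPair p₀ p₁ k).no :=
  side_zero_subset_no (n + 1) (kit.samp_support false n w hw)

/-- The planted law of side `true` lives on YES instances. -/
theorem law_true_support (kit : OrbitKit p₀ p₁ k) (n : ℕ) (w : List Bool)
    (hw : w ∈ (kit.law true n).support) : w ∈ (OrbitPair p₀ p₁ k).yes :=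
  side_one_subset_yes (n + 1) (kit.samp_support true n w hw)

/-- The mixture is supported on the promise of `OrbitPair`. -/
theorem mix_support (kit : OrbitKit p₀ p₁ k) (n : ℕ) (w : List Bool) (hw : w ∈ (kit.mix n).support) :
    w ∈ (OrbitPair p₀ p₁ k).yes ∨ w ∈ (OrbitPair p₀ p₁ k).no := by
  rcases (mem_support_mixEnsemble_iff _ _ n w).1 hw with h | h
  · exact Or.inr (kit.law_false_support n w h)
  · exact Or.inl (kit.law_true_support n w h)

end OrbitKit

end Glue

/-! ## §4 Composition -/

/-- **The line, arrow form.** The five stub statements imply the unfolded crux: from worst-case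
hardness of `PEA 3`, the orbit pair of `stub_transfer` is worst-case hard (`stub_randClosure`); its
planted mixture (`stub_orbitKit`) is samplable and on the promise; were it `HeurBPP`-easy it would be
`UHeurBPP`-easy (`stub_adviceElim`) and the orbit RSR (`stub_orbitRSR`) would decide `OrbitPair` —
contradiction; finally hardness is pushed to `PEA 3` along `OrbitPair ≤ₚ PEA 3` (identity). -/
theorem conclusion_of_parts
    (hT : ∃ (p₀ p₁ : (s : ℕ) → PolyMapF2 s) (k : ℕ → ℕ),
      IsPUniform p₀ k ∧ IsPUniform p₁ k ∧ (∀ s, (p₀ s).DegLE 3) ∧ (∀ s, (p₁ s).DegLE 3) ∧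
      (∀ s, s ≤ (p₀ s).length ∧ s ≤ (p₁ s).length) ∧ Separated p₀ p₁ k ∧
      PromiseRandReducible (PEA 3) (OrbitPair p₀ p₁ k))
    (hC : ∀ Q₁ Q₂ : PromiseProblem, PromiseRandReducible Q₁ Q₂ → Q₂ ∈ PromiseBPP' → Q₁ ∈ PromiseBPP')
    (hK : ∀ (p₀ p₁ : (s : ℕ) → PolyMapF2 s) (k : ℕ → ℕ),
      IsPUniform p₀ k → IsPUniform p₁ k → (∀ s, (p₀ s).DegLE 3) → (∀ s, (p₁ s).DegLE 3) →
      (∀ s, s ≤ (p₀ s).length ∧ s ≤ (p₁ s).length) → Nonempty (OrbitKit p₀ p₁ k))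
    (hE : ∀ (Q : PromiseProblem), Q.Disjoint → ∀ (S : Bool → RandAlg ℕ (List Bool)),
      (∀ b, (S b).IsPolyTime unaryEncodeNat (id : List Bool → List Bool)) →
      ∀ c : Polynomial ℕ, (∀ b ℓ, (S b).coinLen ℓ = c.eval ℓ) →
      (∀ n, ∀ w ∈ ((S false).outputPMF unaryEncodeNat n).support, w ∈ Q.no) →
      (∀ n, ∀ w ∈ ((S true).outputPMF unaryEncodeNat n).support, w ∈ Q.yes) →
      (⟨Q.yes, mixEnsemble (fun n => (S false).outputPMF unaryEncodeNat n)
          (fun n => (S true).outputPMF unaryEncodeNat n)⟩ : DistProblem) ∈ HeurBPP →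
      (⟨Q.yes, mixEnsemble (fun n => (S false).outputPMF unaryEncodeNat n)
          (fun n => (S true).outputPMF unaryEncodeNat n)⟩ : DistProblem) ∈ UHeurBPP)
    (hR : ∀ (p₀ p₁ : (s : ℕ) → PolyMapF2 s) (k : ℕ → ℕ) (kit : OrbitKit p₀ p₁ k),
      (∀ s, s ≤ (p₀ s).length ∧ s ≤ (p₁ s).length) → (OrbitPair p₀ p₁ k).Disjoint →
      (⟨(OrbitPair p₀ p₁ k).yes, kit.mix⟩ : DistProblem) ∈ UHeurBPP → OrbitPair p₀ p₁ k ∈ PromiseBPP') :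
    PEA 3 ∉ PromiseBPP' → ∃ D : Ensemble, D.IsPolySamplable ∧
      (∀ n : ℕ, ∀ w ∈ (D n).support, w ∈ (PEA 3).yes ∨ w ∈ (PEA 3).no) ∧
      (⟨(PEA 3).yes, D⟩ : DistProblem) ∉ HeurBPP := by
  intro hA
  obtain ⟨p₀, p₁, k, hu₀, hu₁, hd₀, hd₁, hlen, hsep, hred⟩ := hT
  have hhard : OrbitPair p₀ p₁ k ∉ PromiseBPP' := fun h => hA (hC _ _ hred h)
  have hdisj : (OrbitPair p₀ p₁ k).Disjoint := orbitPair_disjoint hsep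
  obtain ⟨kit⟩ := hK p₀ p₁ k hu₀ hu₁ hd₀ hd₁ hlen
  refine exists_hard_samplable_of_polyTimeReducible (PEA_disjoint 3)
    (orbitPair_polyTimeReducible_PEA hsep) ⟨kit.mix, kit.isPolySamplable_mix, kit.mix_support, ?_⟩
  intro hmix
  exact hhard (hR p₀ p₁ k kit hlen hdisj
    (hE (OrbitPair p₀ p₁ k) hdisj kit.samp kit.samp_polyTime kit.sampCoins kit.samp_coinLen
      kit.law_false_support kit.law_true_support hmix))

/-- **The skeleton concludes the crux BY NAME**: `PeaWorstToAvg` from the five stubs. -/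
theorem PeaWorstToAvg_of : Summit.PneNP.PneNP.Theses.SzkEntropy.PeaWorstToAvg :=
  szkEntropy_peaWorstToAvg_iff.2
    (conclusion_of_parts stub_transfer stub_randClosure stub_orbitKit stub_adviceElim stub_orbitRSR)

end Summit.PneNP.PneNP.Cruxes.PeaWorstToAvg.OrbitPairRsr
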